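import Summits.QuantumFields.YangMills.Theorems.LuscherReductionOneSiteLevelsAbsLowerPrep
import HarnessLib

/-!
# The one-site quasimode estimate at a GENERAL cut-off radius `R` (rate-twin input of the FLOOR WITH RATE of `stub_boRate`;
# route `FlatTubeReduction`, crux K1 `NearFlatRatioLaw` stmt-QuantumFields-24720; R2b1 RECORD rung — no summit statement is proved here)

Seat `ym-line-ftr-p1` g9 (prover).  Crux ONE's per-trial-state estimate `trial_estimate` (`…OneSiteLevelsAbsLowerPrep`, seat ym-luscher-20007-p2) bounds the
one-site transfer form of the gnomonic pull-back `Ψ_a = (χ_R·Σ_j a_j f_j) ∘ gnCoord μ` of cut-off eigenfunctions of Lüscher's matrix Hamiltonian `𝔥` from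
below by `8e^{6B}Zc²‖G_a‖²(1 − 2μE − μ²K)` — at the FIXED cut-off radius `R = 1/(8μ)` (support of `Ψ_a` = a ball of radius `O(1)` in link coordinates).
The FLOOR WITH RATE of the Born–Oppenheimer door with rate (`Cruxes/NearFlatRatioLaw/Lines/borate.lean`, clause `N·μ₀·e^{−C u²} ≤ λ₀(β,L)`) needs a
one-site trial amplitude that is localised INSIDE THE SLOW CORE of the tube chart (support radius `→ 0`) and concentrated at the slow scale `μ = λ_b/2`
in the second-moment sense; this is the same trial state with a SHRINKING cut-off radius `1 ≤ R ≤ 1/(8μ)`.  This file is the verbatim generalisation: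
★ `trial_estimate_of_cutoff` — the estimate of `trial_estimate` for every `R` with `1 ≤ R ≤ 1/(8μ)` and `e^{−R} ≤ 3072μ³` (the only three properties of
`R = 1/(8μ)` the original proof uses).  The concentrated quasimode itself is the sequel `…FlatTubeReductionOneSiteQuasimode`.
HONEST FRAMING: bookkeeping over crux ONE's landed analysis (the eigenfunction data enter as hypotheses); an input of the rate twin of RED lane A's C4-CORE for
the femto rung R2b1 (RECORD label); not infinite volume, not a mass gap, not Clay.  No new definitions, no named facts, no `sorry`.
-/

set_option autoImplicit false

noncomputable section

open MeasureTheory Filter Topology Real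
open scoped Matrix ENNReal
open Literature.MathematicalPhysics.QuantumFieldTheory
open Literature.MathematicalPhysics.QuantumLattice
open Literature.Analysis.OperatorTheory.YMMatrixModel

namespace Summit.QuantumFields.YangMills.Theorems.FemtoTransferGap

namespace Quasimode

variable {k : ℕ} {f : Fin (k + 1) → ZM → ℝ}

/-- ★ **The per-trial-state estimate at a general cut-off radius.**  Eigenfunction data `f` (smooth, colour-invariant, with decay `|f_j| ≤ C_f e^{−‖x‖}` and
quasimode constant `A`), chart scale `μ` with `Bμ³ = 1/4` and the smallness conditions `μ ≤ 1/8`, `A(k+1)·3072μ³ ≤ 1/2`, `π ≤ B`; cut-off radius `R` with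
`1 ≤ R ≤ 1/(8μ)` and `e^{−R} ≤ 3072μ³`.  Then for every coefficient vector `a`,
`8 e^{6B} Z c² ‖G_a‖² (1 − 2μE − μ²K) ≤ ⟨Ψ_a, K_B Ψ_a⟩`, `Ψ_a = trialMap f R μ a`, `G_a = cutSpan f R a`, `E = physLevel (k+1)`,
`K = absLowerK E A ((k+1)C_f² ∫e^{−‖y‖}) k` — the same constant as crux ONE's `trial_estimate` (which is the case `R = 1/(8μ)`).
[cite: Luscher1983, §2] [cite: ReedSimonIV1978, Thm. XIII.1–2] -/
theorem trial_estimate_of_cutoff (hsmooth : ∀ j, ∀ n : ℕ∞, ContDiff ℝ n (f j)) (hinv : ∀ j, IsGaugeInv (f j))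
    {Cf : ℝ} (hCf : ∀ j x, |f j x| ≤ Cf * Real.exp (-‖x‖))
    {A : ℝ} (hA0 : 0 ≤ A)
    (hq : ∀ R : ℝ, 1 ≤ R → ∀ a : Fin (k + 1) → ℝ,
      energyForm (radialCutoff R * fun x => ∑ j, a j * f j x) ≤
          physLevel (k + 1) * l2sq (radialCutoff R * fun x => ∑ j, a j * f j x) + A * Real.exp (-R) * ∑ i, ∑ j, |a i| * |a j| ∧
      ∑ j, a j ^ 2 - A * Real.exp (-R) * ∑ i, ∑ j, |a i| * |a j| ≤ l2sq (radialCutoff R * fun x => ∑ j, a j * f j x))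
    {B μ : ℝ} (hB : 0 < B) (hμ : 0 < μ) (hBμ : B * μ ^ 3 = 1 / 4) (hμ8 : μ ≤ 1 / 8) (hεμ : A * (k + 1) * (3072 * μ ^ 3) ≤ 1 / 2)
    (hBπ : π ≤ B) {R : ℝ} (hR1 : 1 ≤ R) (hRμ : R ≤ 1 / (8 * μ)) (heR : Real.exp (-R) ≤ 3072 * μ ^ 3) (a : Fin (k + 1) → ℝ) :
    8 * Real.exp (6 * B) * Real.sqrt (π / (B * μ ^ 2)) ^ 9 * (μ ^ 9 * ((2 * π ^ 2)⁻¹) ^ 3) ^ 2 *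
        (∫ y, cutSpan f R a y ^ 2) *
        (1 - 2 * μ * physLevel (k + 1) - μ ^ 2 * absLowerK (physLevel (k + 1)) A ((k + 1) * Cf ^ 2 * ∫ y : ZM, Real.exp (-‖y‖)) k) ≤
      qform su2Rep B (trialMap f R μ a) (trialMap f R μ a) := by
  -- parameters and data
  have hR0 : 0 < R := lt_of_lt_of_le one_pos hR1
  have hE0 : 0 ≤ physLevel (k + 1) := physLevel_nonneg (Nat.succ_le_succ (Nat.zero_le k))
  have hJ0 : 0 ≤ ∫ y : ZM, Real.exp (-‖y‖) := integral_nonneg fun y => (Real.exp_pos _).le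
  have hMom0 : 0 ≤ (k + 1) * Cf ^ 2 * ∫ y : ZM, Real.exp (-‖y‖) := by positivity
  obtain ⟨hGtest, hGinv⟩ := isTestFn_isGaugeInv_radialCutoff_mul_span hR0 hsmooth hinv a
  have hGeq : (radialCutoff R * fun x => ∑ j, a j * f j x) = cutSpan f R a := rfl
  rw [hGeq] at hGtest hGinv
  have hsupp : ∀ y, cutSpan f R a y ≠ 0 → ‖y‖ ≤ Real.sqrt 2 * R := fun y hy =>
    norm_le_of_cutSpan_ne_zero f hR0 a hy
  have hwin : μ ^ 2 * (Real.sqrt 2 * R) ^ 2 ≤ 1 / 16 := by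
    rw [sq_sqrt_two_mul]
    have h1 : μ * R ≤ 1 / 8 := by
      have := mul_le_mul_of_nonneg_left hRμ hμ.le
      rwa [show μ * (1 / (8 * μ)) = 1 / 8 by field_simp] at this
    have h0 : 0 ≤ μ * R := mul_nonneg hμ.le hR0.le
    nlinarith
  have hμhalf : μ ≤ 1 / 2 := by linarith
  have hμ1 : μ ≤ 1 := by linarith
  -- the structural bound
  have hmain := qform_gnTrial_ge hB hμ hBμ hGtest hGinv hsupp hwin
  -- quasimode data
  obtain ⟨hq1, hq2⟩ := hq R hR1 a
  rw [hGeq] at hq1 hq2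
  have hl2sq : l2sq (cutSpan f R a) = ∫ y, cutSpan f R a y ^ 2 := rfl
  rw [hl2sq] at hq1 hq2
  -- names for the real numbers involved (via `generalize`, so that all occurrences are syntactically uniform)
  have eT : trialMap f R μ a = fun U => cutSpan f R a (gnCoord μ U) := rfl
  rw [eT]
  generalize hGdef : cutSpan f R a = G at hGtest hGinv hsupp hmain hq1 hq2 ⊢
  generalize hEdef : physLevel (k + 1) = E at hE0 hq1 ⊢
  generalize hJdef : ∫ y : ZM, Real.exp (-‖y‖) = J at hJ0 hMom0 ⊢
  have hn20 : 0 ≤ ∑ j, a j ^ 2 := Finset.sum_nonneg fun j _ => sq_nonneg _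
  have hN0 : 0 ≤ ∫ y, G y ^ 2 := integral_nonneg fun y => sq_nonneg _
  have hSn : ∑ i, ∑ j, |a i| * |a j| ≤ (k + 1) * ∑ j, a j ^ 2 := sum_abs_mul_abs_le a
  generalize hn2def : ∑ j, a j ^ 2 = n2 at hn20 hSn hq2 ⊢
  generalize hSdef : ∑ i, ∑ j, |a i| * |a j| = S at hSn hq1 hq2
  generalize hNdef : ∫ y, G y ^ 2 = N at hN0 hq1 hq2 hmain ⊢
  -- `e^{−R} ≤ 3072 μ³`, the tail `A e^{−R} S ≤ A(k+1)·3072μ³ · n2 ≤ n2/2`, and `n2 ≤ 2N`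
  have heR : Real.exp (-R) ≤ 3072 * μ ^ 3 := heR
  have hAS : A * Real.exp (-R) * S ≤ A * (k + 1) * (3072 * μ ^ 3) * n2 := by
    calc A * Real.exp (-R) * S ≤ A * Real.exp (-R) * ((k + 1) * n2) :=
          mul_le_mul_of_nonneg_left hSn (by positivity)
      _ ≤ A * (3072 * μ ^ 3) * ((k + 1) * n2) := by gcongr
      _ = A * (k + 1) * (3072 * μ ^ 3) * n2 := by ring
  have hASn : A * (k + 1) * (3072 * μ ^ 3) * n2 ≤ (1 / 2) * n2 := mul_le_mul_of_nonneg_right hεμ hn20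
  have hn2N : n2 ≤ 2 * N := by linarith only [hq2, hAS, hASn]
  -- moments of `G`
  have hM : ∀ m : ℕ, ∫ y, ‖y‖ ^ m * G y ^ 2 ≤ (m.factorial : ℝ) * ((k + 1) * Cf ^ 2 * J) * n2 := fun m => by
    rw [← hGdef, ← hJdef, ← hn2def]; exact integral_pow_mul_cutSpan_sq_le (f := f) hCf R a m
  generalize hMomdef : (k + 1) * Cf ^ 2 * J = Mom at hMom0 hM ⊢
  have hM2 := hM 2
  have hM6 := hM 6
  have hM10 := hM 10
  have f2 : ((2 : ℕ).factorial : ℝ) = 2 := by norm_num [Nat.factorial]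
  have f6 : ((6 : ℕ).factorial : ℝ) = 720 := by norm_num [Nat.factorial]
  have f10 : ((10 : ℕ).factorial : ℝ) = 3628800 := by norm_num [Nat.factorial]
  rw [f2] at hM2; rw [f6] at hM6; rw [f10] at hM10
  have hM2' : ∫ y, ‖y‖ ^ 2 * G y ^ 2 ≤ 4 * Mom * N := by
    calc ∫ y, ‖y‖ ^ 2 * G y ^ 2 ≤ 2 * Mom * n2 := hM2
      _ ≤ 2 * Mom * (2 * N) := mul_le_mul_of_nonneg_left hn2N (by positivity)
      _ = 4 * Mom * N := by ring
  have hm0 : 0 ≤ ∫ y, ‖y‖ ^ 2 * G y ^ 2 := integral_nonneg fun y => by positivity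
  -- energy split and the gradient bound
  have hGc : Continuous G := hGtest.continuous
  have hG2s : HasCompactSupport fun y => G y ^ 2 := GaussForm.hasCompactSupport_sq hGtest.2
  have hD : Integrable fun y => ‖gradient G y‖ ^ 2 := by
    have hG1 : ContDiff ℝ 1 G := hGtest.1.of_le (by norm_num)
    simp_rw [GaussForm.norm_gradient_eq]
    exact (((hG1.continuous_fderiv one_ne_zero).norm).pow 2).integrable_of_hasCompactSupport
      (GaussForm.hasCompactSupport_sq (hGtest.2.fderiv (𝕜 := ℝ)).norm)
  have hV : Integrable fun y => luscherPotential y * G y ^ 2 := hGtest.integrable_mul_sq continuous_luscherPotential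
  have hEsplit : energyForm G = (1 / 2 : ℝ) * (∫ y, ‖gradient G y‖ ^ 2) + ∫ y, luscherPotential y * G y ^ 2 := by
    rw [energyForm, integral_add (hD.const_mul _) hV, integral_const_mul]
  have hVG0 : 0 ≤ ∫ y, luscherPotential y * G y ^ 2 := integral_nonneg fun y => mul_nonneg (luscherPotential_nonneg y) (sq_nonneg _)
  have hDle : ∫ y, ‖gradient G y‖ ^ 2 ≤ 2 * (E * N) + 2 * N := by linarith only [hEsplit, hq1, hAS, hASn, hn2N, hVG0]
  -- the `gnLip` moment
  have hm : ∀ m : ℕ, Integrable fun y => ‖y‖ ^ m * G y ^ 2 := fun m =>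
    ((continuous_norm.pow m).mul (hGc.pow 2)).integrable_of_hasCompactSupport hG2s.mul_left
  have hL : ∫ y, G y ^ 2 * gnLip B μ y ^ 2 ≤ μ ^ 2 * (98677656 * Mom * n2) := by
    have i1 : Integrable fun y => 108 * (‖y‖ ^ 2 * G y ^ 2) := (hm 2).const_mul _
    have i2 : Integrable fun y => 972 * (‖y‖ ^ 6 * G y ^ 2) := (hm 6).const_mul _
    have i3 : Integrable fun y => 27 * (‖y‖ ^ 10 * G y ^ 2) := (hm 10).const_mul _
    have i12 : Integrable fun y => 108 * (‖y‖ ^ 2 * G y ^ 2) + 972 * (‖y‖ ^ 6 * G y ^ 2) := i1.add i2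
    have i123 : Integrable fun y => 108 * (‖y‖ ^ 2 * G y ^ 2) + 972 * (‖y‖ ^ 6 * G y ^ 2) + 27 * (‖y‖ ^ 10 * G y ^ 2) := i12.add i3
    have hpt : ∀ y, G y ^ 2 * gnLip B μ y ^ 2 ≤ μ ^ 2 * (108 * (‖y‖ ^ 2 * G y ^ 2) + 972 * (‖y‖ ^ 6 * G y ^ 2) + 27 * (‖y‖ ^ 10 * G y ^ 2)) := by
      intro y
      have := mul_le_mul_of_nonneg_left (gnLip_sq_le hμ hμhalf hBμ y) (sq_nonneg (G y))
      linarith only [this]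
    calc ∫ y, G y ^ 2 * gnLip B μ y ^ 2 ≤ ∫ y, μ ^ 2 * (108 * (‖y‖ ^ 2 * G y ^ 2) + 972 * (‖y‖ ^ 6 * G y ^ 2) + 27 * (‖y‖ ^ 10 * G y ^ 2)) :=
          integral_mono_of_nonneg (ae_of_all _ fun y => by positivity) (i123.const_mul _) (ae_of_all _ hpt)
      _ = μ ^ 2 * (108 * (∫ y, ‖y‖ ^ 2 * G y ^ 2) + 972 * (∫ y, ‖y‖ ^ 6 * G y ^ 2) + 27 * ∫ y, ‖y‖ ^ 10 * G y ^ 2) := by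
          rw [integral_const_mul, integral_add i12 i3, integral_add i1 i2, integral_const_mul, integral_const_mul, integral_const_mul]
      _ ≤ μ ^ 2 * (98677656 * Mom * n2) := by
          refine mul_le_mul_of_nonneg_left ?_ (sq_nonneg μ)
          linarith only [hM2, hM6, hM10]
  -- `Bμ² = 1/(4μ)` hence `4/(e·Bμ²) ≤ 16μ`
  have hBμ2 : B * μ ^ 2 = 1 / (4 * μ) := by
    rw [eq_div_iff (by positivity)]; linear_combination 4 * hBμ
  have he1 : 1 ≤ Real.exp 1 := Real.one_le_exp (by norm_num)
  have hfrac : 4 / (Real.exp 1 * (B * μ ^ 2)) ≤ 16 * μ := by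
    rw [hBμ2, div_le_iff₀ (by positivity)]
    have e4 : 16 * μ * (Real.exp 1 * (1 / (4 * μ))) = 4 * Real.exp 1 := by field_simp; ring
    rw [e4]; linarith only [he1]
  have hκ := kappa_le
  have hκ0 : 0 ≤ 8 / (3 * Real.exp 1) := by positivity
  have hs2 := sqrt_two_pow_nine_le
  -- the five pieces of ERR, each `≤ μ² · const · N`
  have t1 : 12 * μ ^ 2 * (∫ y, ‖y‖ ^ 2 * G y ^ 2) ≤ μ ^ 2 * (48 * Mom * N) := by
    have := mul_le_mul_of_nonneg_left hM2' (sq_nonneg μ); linarith only [this]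
  have t2 : 2 * μ ^ 2 * (∫ y, ‖gradient G y‖ ^ 2) ≤ μ ^ 2 * ((4 * E + 4) * N) := by
    have := mul_le_mul_of_nonneg_left hDle (sq_nonneg μ); linarith only [this]
  have t3 : 9 * (μ + 1 / 2) * (∫ y, G y ^ 2 * gnLip B μ y ^ 2) ≤ μ ^ 2 * (18 * 98677656 * Mom * N) := by
    have hl0 : 0 ≤ ∫ y, G y ^ 2 * gnLip B μ y ^ 2 := integral_nonneg fun y => by positivity
    have h91 : 9 * (μ + 1 / 2) ≤ 9 := by linarith
    have a1 : 9 * (μ + 1 / 2) * (∫ y, G y ^ 2 * gnLip B μ y ^ 2) ≤ 9 * ∫ y, G y ^ 2 * gnLip B μ y ^ 2 :=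
      mul_le_mul_of_nonneg_right h91 hl0
    have a2 : μ ^ 2 * (98677656 * Mom * n2) ≤ μ ^ 2 * (98677656 * Mom * (2 * N)) :=
      mul_le_mul_of_nonneg_left (mul_le_mul_of_nonneg_left hn2N (by positivity)) (sq_nonneg μ)
    linarith only [a1, a2, hL]
  have t4 : μ ^ 2 * (8 / (3 * Real.exp 1)) * (3 * Real.sqrt 2 ^ 9 * (∫ y, ‖y‖ ^ 2 * G y ^ 2)) ≤ μ ^ 2 * (736 * Mom * N) := by
    have h1 : Real.sqrt 2 ^ 9 * (∫ y, ‖y‖ ^ 2 * G y ^ 2) ≤ 23 * (4 * Mom * N) := mul_le_mul hs2 hM2' hm0 (by norm_num)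
    have h2 : (8 / (3 * Real.exp 1)) * (3 * Real.sqrt 2 ^ 9 * (∫ y, ‖y‖ ^ 2 * G y ^ 2)) ≤ (8 / 3) * (3 * (23 * (4 * Mom * N))) :=
      mul_le_mul hκ (by linarith only [h1]) (mul_nonneg (by positivity) hm0) (by norm_num)
    have h3 := mul_le_mul_of_nonneg_left h2 (sq_nonneg μ)
    linarith only [h3]
  have t5 : μ ^ 2 * (8 / (3 * Real.exp 1)) * (2 * (4 / (Real.exp 1 * (B * μ ^ 2)) * (2 : ℝ) ^ 9) * N) ≤ μ ^ 2 * (21846 * N) := by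
    have h1 : 4 / (Real.exp 1 * (B * μ ^ 2)) * (2 : ℝ) ^ 9 ≤ 16 * μ * (2 : ℝ) ^ 9 := mul_le_mul_of_nonneg_right hfrac (by norm_num)
    have h2 : 2 * (4 / (Real.exp 1 * (B * μ ^ 2)) * (2 : ℝ) ^ 9) * N ≤ 2 * (16 * μ * (2 : ℝ) ^ 9) * N := by
      have := mul_le_mul_of_nonneg_right h1 hN0; linarith only [this]
    have h3 : 2 * (16 * μ * (2 : ℝ) ^ 9) * N ≤ 8192 * N := by
      have := mul_le_mul_of_nonneg_right hμhalf hN0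
      have e : 2 * (16 * μ * (2 : ℝ) ^ 9) * N = 16384 * (μ * N) := by ring
      rw [e]; linarith only [this]
    have h4 : (8 / (3 * Real.exp 1)) * (2 * (4 / (Real.exp 1 * (B * μ ^ 2)) * (2 : ℝ) ^ 9) * N) ≤ (8 / 3) * (8192 * N) :=
      mul_le_mul hκ (h2.trans h3) (mul_nonneg (by positivity) hN0) (by norm_num)
    have h5 := mul_le_mul_of_nonneg_left h4 (sq_nonneg μ)
    have hμN : 0 ≤ μ ^ 2 * N := mul_nonneg (sq_nonneg μ) hN0
    linarith only [h5, hμN]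
  -- the energy term
  have hEn : 2 * μ * energyForm G ≤ 2 * μ * (E * N) + μ ^ 2 * (12288 * A * (k + 1) * N) := by
    have h1 : energyForm G ≤ E * N + A * (k + 1) * (3072 * μ ^ 3) * n2 := by linarith only [hq1, hAS]
    have h2 : 2 * μ * energyForm G ≤ 2 * μ * (E * N + A * (k + 1) * (3072 * μ ^ 3) * n2) := mul_le_mul_of_nonneg_left h1 (by positivity)
    have h3 : A * (k + 1) * (3072 * μ ^ 3) * n2 ≤ A * (k + 1) * (3072 * μ ^ 3) * (2 * N) := mul_le_mul_of_nonneg_left hn2N (by positivity)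
    have hμ4 : μ ^ 4 ≤ μ ^ 2 := pow_le_pow_of_le_one hμ.le hμ1 (by norm_num)
    have h4 : 2 * μ * (A * (k + 1) * (3072 * μ ^ 3) * (2 * N)) = 12288 * A * (k + 1) * N * μ ^ 4 := by ring
    have h5 : 12288 * A * (k + 1) * N * μ ^ 4 ≤ 12288 * A * (k + 1) * N * μ ^ 2 := mul_le_mul_of_nonneg_left hμ4 (by positivity)
    have h6 := mul_le_mul_of_nonneg_left h3 (by positivity : 0 ≤ 2 * μ)
    linarith only [h2, h6, h4, h5]
  -- the cross term
  have hP0 : 0 < 8 * Real.exp (6 * B) * Real.sqrt (π / (B * μ ^ 2)) ^ 9 * (μ ^ 9 * ((2 * π ^ 2)⁻¹) ^ 3) ^ 2 := by positivity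
  have hZc : Real.sqrt (π / (B * μ ^ 2)) ^ 9 * (μ ^ 9 * ((2 * π ^ 2)⁻¹) ^ 3) = Real.sqrt (π / B) ^ 9 / (2 * π ^ 2) ^ 3 := by
    rw [← mul_assoc, sqrt_div_mul_sq_pow_mul B μ hB hμ]; ring
  have hct := cross_term_le hBπ
  have hKc0 : 0 ≤ (2 * π ^ 2) ^ 3 * 720 * (4 / 15) ^ 6 / π ^ 5 := by positivity
  have e1 : 7 * Real.exp (9 / 4 * B) * (μ ^ 9 * ((2 * π ^ 2)⁻¹) ^ 3) =
      (8 * Real.exp (6 * B) * Real.sqrt (π / (B * μ ^ 2)) ^ 9 * (μ ^ 9 * ((2 * π ^ 2)⁻¹) ^ 3) ^ 2) *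
        ((7 / 8) * (Real.exp (-(15 / 4 * B)) * (2 * π ^ 2) ^ 3 / Real.sqrt (π / B) ^ 9)) := by
    have e0 : 8 * Real.exp (6 * B) * Real.sqrt (π / (B * μ ^ 2)) ^ 9 * (μ ^ 9 * ((2 * π ^ 2)⁻¹) ^ 3) ^ 2 =
        8 * Real.exp (6 * B) * (Real.sqrt (π / (B * μ ^ 2)) ^ 9 * (μ ^ 9 * ((2 * π ^ 2)⁻¹) ^ 3)) * (μ ^ 9 * ((2 * π ^ 2)⁻¹) ^ 3) := by
      ring
    rw [e0, hZc]
    have hexp : Real.exp (9 / 4 * B) = Real.exp (6 * B) * Real.exp (-(15 / 4 * B)) := by rw [← Real.exp_add]; ring_nf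
    rw [hexp]
    have key : Real.sqrt (π / B) ^ 9 / (2 * π ^ 2) ^ 3 * ((2 * π ^ 2) ^ 3 / Real.sqrt (π / B) ^ 9) = 1 := by
      rw [div_mul_div_comm, mul_comm (Real.sqrt (π / B) ^ 9), div_self (by positivity)]
    rw [show 8 * Real.exp (6 * B) * (Real.sqrt (π / B) ^ 9 / (2 * π ^ 2) ^ 3) * (μ ^ 9 * ((2 * π ^ 2)⁻¹) ^ 3) *
        (7 / 8 * (Real.exp (-(15 / 4 * B)) * (2 * π ^ 2) ^ 3 / Real.sqrt (π / B) ^ 9)) =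
        7 * (Real.exp (6 * B) * Real.exp (-(15 / 4 * B))) * (μ ^ 9 * ((2 * π ^ 2)⁻¹) ^ 3) *
        (Real.sqrt (π / B) ^ 9 / (2 * π ^ 2) ^ 3 * ((2 * π ^ 2) ^ 3 / Real.sqrt (π / B) ^ 9)) by ring, key, mul_one]
  have e2 : (1 : ℝ) / B = 4 * μ ^ 3 := by
    have : B = 1 / (4 * μ ^ 3) := by rw [eq_div_iff (by positivity)]; linear_combination 4 * hBμ
    rw [this, one_div_one_div]
  -- abstract the large atoms
  generalize hKcdef : (2 * π ^ 2) ^ 3 * 720 * (4 / 15) ^ 6 / π ^ 5 = Kc at hct hKc0 ⊢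
  rw [div_eq_mul_one_div Kc B, e2] at hct
  generalize hXdef : Real.exp (-(15 / 4 * B)) * (2 * π ^ 2) ^ 3 / Real.sqrt (π / B) ^ 9 = X at hct e1
  generalize hPdef : 8 * Real.exp (6 * B) * Real.sqrt (π / (B * μ ^ 2)) ^ 9 * (μ ^ 9 * ((2 * π ^ 2)⁻¹) ^ 3) ^ 2 = P at hP0 hmain e1 ⊢
  generalize hcdef : μ ^ 9 * ((2 * π ^ 2)⁻¹) ^ 3 = c at e1 hmain
  have hμ32 : μ ^ 3 ≤ μ ^ 2 := pow_le_pow_of_le_one hμ.le hμ1 (by norm_num)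
  have h43 : 4 * μ ^ 3 ≤ 4 * μ ^ 2 := by linarith [hμ32]
  have hX : X ≤ Kc * (4 * μ ^ 2) := hct.trans (mul_le_mul_of_nonneg_left h43 hKc0)
  have hcross : 7 * Real.exp (9 / 4 * B) * c * N ≤ P * N * (μ ^ 2 * (4 * Kc * (7 / 8))) := by
    rw [e1]
    have hPN : 0 ≤ P * N := mul_nonneg hP0.le hN0
    have := mul_le_mul_of_nonneg_left hX hPN
    linarith only [this]
  -- put together
  have hERR : 12 * μ ^ 2 * (∫ y, ‖y‖ ^ 2 * G y ^ 2) + 2 * μ ^ 2 * (∫ y, ‖gradient G y‖ ^ 2)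
        + 9 * (μ + 1 / 2) * (∫ y, G y ^ 2 * gnLip B μ y ^ 2)
        + μ ^ 2 * (8 / (3 * Real.exp 1)) * (3 * Real.sqrt 2 ^ 9 * (∫ y, ‖y‖ ^ 2 * G y ^ 2)
          + 2 * (4 / (Real.exp 1 * (B * μ ^ 2)) * (2 : ℝ) ^ 9) * N) ≤
      μ ^ 2 * ((48 * Mom + (4 * E + 4) + 18 * 98677656 * Mom + 736 * Mom + 21846) * N) := by
    linarith only [t1, t2, t3, t4, t5]
  unfold absLowerK
  rw [hKcdef]
  have hfin := mul_le_mul_of_nonneg_left hERR hP0.le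
  have hfin2 := mul_le_mul_of_nonneg_left hEn hP0.le
  linarith only [hmain, hfin, hfin2, hcross]

end Quasimode

end Summit.QuantumFields.YangMills.Theorems.FemtoTransferGap

end
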